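import Mathlib.LinearAlgebra.Matrix.GeneralLinearGroup.Card
import Summits.PneNP.PneNP.Theorems.SzkEntropyPeaThreeNotInPStubJSD
import Summits.PneNP.PneNP.Theorems.SzkEntropyPeaThreeNotInPStubEvent
import Summits.PneNP.PneNP.Theorems.SzkEntropyPeaThreeNotInPStubDensity

/-!
# Route SzkEntropy, crux `PeaThreeNotInP` (stmt-PneNP-10776), line `SketchIdeator3`: law invariance and
# the entropy gap of the monoid-randomised sampler (registered stub `stub_gap`)

For 3-tensors `S, T` over `F₂` smeared by ALL matrix triples `M = (A,B,C)` (`tensorAct`, `sampler`,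
`mixSampler` of `SzkEntropyPeaThreeNotInPTensorIsoDefs.lean`):

* the monoid law `tensorAct_tensorAct`, the `Iso` API, and **law invariance** `law_eq_of_iso`
  (isomorphic tensors give identically distributed samples: right multiplication by an invertible
  triple permutes the sample space), hence `samplerEntropy_eq_of_iso` and — via the generic
  `mapEntropy_eq_of_law_eq` / `mixture_entropy_eq_of_law_eq` — `mixEntropy_eq_of_iso`;
* the abstract gap `mixEntropy_ge_of_event_density` (event analysis + density feed `stub_jsd`), the
  density of invertible triples `card_triple_le` (from `stub_density`), and **`stub_gap`**: for CONCISE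
  non-isomorphic `S, T`, `H(mix) ≥ (H_S + H_T)/2 + 1/64`; for isomorphic ones all entropies agree.

Sources: the line cards `Cruxes/PeaThreeNotInP/Ideas/tensor-iso-monoid-import.md` (lever, first
lemmas) and `…/tensor-orbit-two-query.md` (constants); ideation sketch `Cruxes/…/SketchIdeator3.lean`.
-/

noncomputable section

open Finset Matrix
open scoped Kronecker
open _root_.Computability
open Literature.InformationTheory.Entropy
open Literature.Computability.Complexity

namespace Summit.PneNP.PneNP.Cruxes.PeaThreeNotInP.TensorIsoLine

set_option linter.dupNamespace false -- `Summit.PneNP.PneNP.…`: summit = sub-problem name (D-0017 single-conjunct layout)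

variable {a b c : ℕ}

/-! ### The monoid action and the `Iso` API -/

/-- The action is a monoid action: `M·(g·T) = (M g)·T` (componentwise products). [folklore] -/
theorem tensorAct_tensorAct (M g : Triple a b c) (T : Tensor3 a b c) :
    tensorAct M (tensorAct g T) = tensorAct (M.1 * g.1, M.2.1 * g.2.1, M.2.2 * g.2.2) T := by
  simp only [tensorAct, mul_kronecker_mul, Matrix.transpose_mul, Matrix.mul_assoc]

/-- The identity triple acts trivially. [folklore] -/
theorem tensorAct_one (T : Tensor3 a b c) : tensorAct ((1, 1, 1) : Triple a b c) T = T := by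
  simp [tensorAct]

/-- An invertible triple moves a tensor inside its isomorphism class. [folklore] -/
theorem iso_tensorAct {M : Triple a b c} (hM : IsUnitTriple M) (T : Tensor3 a b c) :
    Iso (tensorAct M T) T :=
  ⟨M, hM.1, hM.2.1, hM.2.2, rfl⟩

/-- `Iso` is reflexive. [folklore] -/
theorem Iso.refl (T : Tensor3 a b c) : Iso T T :=
  ⟨(1, 1, 1), isUnit_one, isUnit_one, isUnit_one, (tensorAct_one T).symm⟩

/-- `Iso` is symmetric (act by the inverse triple). [folklore] -/
theorem Iso.symm {S T : Tensor3 a b c} (h : Iso S T) : Iso T S := by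
  obtain ⟨g, ⟨u₁, hu₁⟩, ⟨u₂, hu₂⟩, ⟨u₃, hu₃⟩, rfl⟩ := h
  refine ⟨(((u₁⁻¹ : (Matrix (Fin a) (Fin a) (ZMod 2))ˣ) : Matrix (Fin a) (Fin a) (ZMod 2)),
    ((u₂⁻¹ : (Matrix (Fin b) (Fin b) (ZMod 2))ˣ) : Matrix (Fin b) (Fin b) (ZMod 2)),
    ((u₃⁻¹ : (Matrix (Fin c) (Fin c) (ZMod 2))ˣ) : Matrix (Fin c) (Fin c) (ZMod 2))),
    (u₁⁻¹).isUnit, (u₂⁻¹).isUnit, (u₃⁻¹).isUnit, ?_⟩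
  rw [tensorAct_tensorAct]
  simp only [← hu₁, ← hu₂, ← hu₃, Units.inv_mul, tensorAct_one]

/-- `Iso` is transitive (products of invertible triples). [folklore] -/
theorem Iso.trans {S T U : Tensor3 a b c} (h₁ : Iso S T) (h₂ : Iso T U) : Iso S U := by
  obtain ⟨g, hg₁, hg₂, hg₃, rfl⟩ := h₁
  obtain ⟨h, hh₁, hh₂, hh₃, rfl⟩ := h₂
  exact ⟨(g.1 * h.1, g.2.1 * h.2.1, g.2.2 * h.2.2), hg₁.mul hh₁, hg₂.mul hh₂, hg₃.mul hh₃,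
    tensorAct_tensorAct g h U⟩

/-- Two invertible smearings that collide force isomorphism: `M·S = M'·T` with `M`, `M'` invertible
triples gives `S ≅ T`. [folklore] -/
theorem iso_of_tensorAct_eq {M M' : Triple a b c} (hM : IsUnitTriple M) (hM' : IsUnitTriple M')
    {S T : Tensor3 a b c} (h : tensorAct M S = tensorAct M' T) : Iso S T :=
  ((iso_tensorAct hM S).symm.trans (h ▸ iso_tensorAct hM' T))

/-- Right multiplication by an invertible triple, as a permutation of ALL triples. [folklore] -/
def rightMul (u₁ : (Matrix (Fin a) (Fin a) (ZMod 2))ˣ) (u₂ : (Matrix (Fin b) (Fin b) (ZMod 2))ˣ)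
    (u₃ : (Matrix (Fin c) (Fin c) (ZMod 2))ˣ) : Triple a b c ≃ Triple a b c :=
  Equiv.prodCongr (Units.mulRight u₁) (Equiv.prodCongr (Units.mulRight u₂) (Units.mulRight u₃))

/-- `rightMul` multiplies componentwise on the right. [folklore] -/
theorem rightMul_apply (u₁ : (Matrix (Fin a) (Fin a) (ZMod 2))ˣ)
    (u₂ : (Matrix (Fin b) (Fin b) (ZMod 2))ˣ) (u₃ : (Matrix (Fin c) (Fin c) (ZMod 2))ˣ)
    (M : Triple a b c) :
    rightMul u₁ u₂ u₃ M = (M.1 * u₁, M.2.1 * u₂, M.2.2 * u₃) := by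
  rcases M with ⟨A, B, C⟩
  rfl

/-! ### Law invariance under isomorphism -/

/-- **Law invariance (first lemma (a) of the card, proved).** Isomorphic tensors give IDENTICALLY
DISTRIBUTED monoid-randomised samples: right multiplication by an invertible triple permutes the
sample space. [card tensor-iso-monoid-import, First lemma (a)] -/
theorem law_eq_of_iso {S T : Tensor3 a b c} (h : Iso S T) (U : Tensor3 a b c) :
    (Finset.univ.filter fun M : Triple a b c => tensorAct M S = U).card =
      (Finset.univ.filter fun M : Triple a b c => tensorAct M T = U).card := by
  obtain ⟨g, ⟨u₁, hu₁⟩, ⟨u₂, hu₂⟩, ⟨u₃, hu₃⟩, rfl⟩ := h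
  have he : ∀ M : Triple a b c,
      tensorAct M (tensorAct g T) = tensorAct (rightMul u₁ u₂ u₃ M) T := by
    intro M
    rw [tensorAct_tensorAct, rightMul_apply, hu₁, hu₂, hu₃]
  have hset : (Finset.univ.filter fun M : Triple a b c => tensorAct M (tensorAct g T) = U) =
      (Finset.univ.filter fun M : Triple a b c => tensorAct M T = U).map
        (rightMul u₁ u₂ u₃).symm.toEmbedding := by
    ext M
    simp only [Finset.mem_filter, Finset.mem_univ, true_and, Finset.mem_map_equiv,
      Equiv.symm_symm, he]
  rw [hset, Finset.card_map]

/-- Law invariance in fibre form. [card tensor-iso-monoid-import, First lemma (a)] -/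
theorem card_fiber_sampler_eq_of_iso {S T : Tensor3 a b c} (h : Iso S T) (U : Tensor3 a b c) :
    (fiber Finset.univ (sampler S) U).card = (fiber Finset.univ (sampler T) U).card :=
  law_eq_of_iso h U

/-- Hence equal sampler entropies for isomorphic tensors (re-indexing invariance of `mapEntropy`).
[card tensor-iso-monoid-import, First lemma (a)] -/
theorem samplerEntropy_eq_of_iso {S T : Tensor3 a b c} (h : Iso S T) :
    samplerEntropy S = samplerEntropy T := by
  obtain ⟨g, ⟨u₁, hu₁⟩, ⟨u₂, hu₂⟩, ⟨u₃, hu₃⟩, rfl⟩ := h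
  have he : (fun M : Triple a b c => tensorAct M T) ∘ (rightMul u₁ u₂ u₃) =
      fun M : Triple a b c => tensorAct M (tensorAct g T) := by
    funext M
    simp only [Function.comp_apply, tensorAct_tensorAct, rightMul_apply, hu₁, hu₂, hu₃]
  unfold samplerEntropy sampler
  rw [← he]
  exact Literature.InformationTheory.Entropy.mapEntropy_univ_comp_equiv (rightMul u₁ u₂ u₃) _

/-! ### Identically distributed maps: equal entropies, equal mixtures -/

section LawEq

variable {ι β : Type*} [Fintype ι] [DecidableEq β]

/-- **Identically distributed maps have the same entropy.** [folklore] -/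
theorem mapEntropy_eq_of_law_eq (f g : ι → β)
    (hlaw : ∀ y, (fiber (univ : Finset ι) f y).card = (fiber (univ : Finset ι) g y).card) :
    mapEntropy (Finset.univ : Finset ι) f = mapEntropy Finset.univ g := by
  classical
  rw [mapEntropy_eq_sum_image, mapEntropy_eq_sum_image]
  have himg : (univ : Finset ι).image f = univ.image g := by
    ext y
    have h1 : y ∉ univ.image f ↔ y ∉ univ.image g := by
      rw [← card_fiber_univ_eq_zero_iff, ← card_fiber_univ_eq_zero_iff, hlaw]
    exact not_iff_not.1 h1
  rw [himg]
  refine Finset.sum_congr rfl fun y _ => ?_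
  rw [hlaw]

/-- **Mixing two identically distributed maps does not change the entropy**: if every fibre of `f`
has the size of the corresponding fibre of `g`, then `H(mix f g) = H(g)`. [folklore] -/
theorem mixture_entropy_eq_of_law_eq [Nonempty ι] (f g : ι → β)
    (hlaw : ∀ y, (fiber (univ : Finset ι) f y).card = (fiber (univ : Finset ι) g y).card) :
    mapEntropy (Finset.univ : Finset (Bool × ι)) (fun p => if p.1 then f p.2 else g p.2) =
      mapEntropy Finset.univ g := by
  classical
  set m : Bool × ι → β := fun p => if p.1 then f p.2 else g p.2 with hm
  set N : ℝ := (Fintype.card ι : ℝ) with hNdef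
  have hN : 0 < N := by
    rw [hNdef]; exact_mod_cast Fintype.card_pos
  set A : β → ℝ := fun y => ((fiber (univ : Finset ι) f y).card : ℝ) with hadef
  set B : β → ℝ := fun y => ((fiber (univ : Finset ι) g y).card : ℝ) with hbdef
  have hAB : ∀ y, A y = B y := fun y => by
    simp only [hadef, hbdef]; exact_mod_cast hlaw y
  have hb_pos : ∀ j, 0 < B (g j) := fun j => by
    simp only [hbdef]; exact_mod_cast card_fiber_pos g (mem_univ j)
  have hfib : ∀ y, ((fiber (univ : Finset (Bool × ι)) m y).card : ℝ) = A y + B y := by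
    intro y
    simp only [hadef, hbdef, fiber, Finset.card_filter, Fintype.sum_prod_type, Fintype.sum_bool,
      hm]
    push_cast
    simp
  have hcard : (((univ : Finset (Bool × ι)).card : ℕ) : ℝ) = 2 * N := by
    rw [Finset.card_univ, Fintype.card_prod, Fintype.card_bool, hNdef]
    push_cast
    ring
  have Hm : mapEntropy (univ : Finset (Bool × ι)) m =
      ((∑ i, Real.logb 2 (2 * N / (A (f i) + B (f i)))) +
        ∑ i, Real.logb 2 (2 * N / (A (g i) + B (g i)))) / (2 * N) := by
    unfold mapEntropy
    rw [hcard]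
    congr 1
    rw [Fintype.sum_prod_type, Fintype.sum_bool]
    congr 1
    · refine Finset.sum_congr rfl fun i _ => ?_
      rw [hfib]
      simp [hm]
    · refine Finset.sum_congr rfl fun i _ => ?_
      rw [hfib]
      simp [hm]
  have Hf : mapEntropy (univ : Finset ι) f = (∑ i, Real.logb 2 (N / A (f i))) / N := by
    simp only [mapEntropy, Finset.card_univ, hNdef, hadef]
  have Hg : mapEntropy (univ : Finset ι) g = (∑ i, Real.logb 2 (N / B (g i))) / N := by
    simp only [mapEntropy, Finset.card_univ, hNdef, hbdef]
  have Hfg : mapEntropy (univ : Finset ι) f = mapEntropy univ g := mapEntropy_eq_of_law_eq f g hlaw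
  -- the two inner sums of `Hm` are `N · H_f` and `N · H_g`
  have h1 : ∑ i, Real.logb 2 (2 * N / (A (f i) + B (f i))) = ∑ i, Real.logb 2 (N / A (f i)) := by
    refine Finset.sum_congr rfl fun i _ => ?_
    rw [← hAB, ← two_mul, mul_div_mul_left _ _ (two_ne_zero)]
  have h2 : ∑ i, Real.logb 2 (2 * N / (A (g i) + B (g i))) = ∑ i, Real.logb 2 (N / B (g i)) := by
    refine Finset.sum_congr rfl fun i _ => ?_
    rw [hAB, ← two_mul, mul_div_mul_left _ _ (two_ne_zero)]
  have hSf : ∑ i, Real.logb 2 (N / A (f i)) = N * mapEntropy (univ : Finset ι) f := by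
    rw [Hf]; field_simp
  have hSg : ∑ i, Real.logb 2 (N / B (g i)) = N * mapEntropy (univ : Finset ι) g := by
    rw [Hg]; field_simp
  rw [Hm, h1, h2, hSf, hSg, Hfg]
  field_simp
  ring

end LawEq

/-- Under isomorphism the mixture has the entropy of either sampler (identical laws).
[card tensor-iso-monoid-import, First lemma (a)] -/
theorem mixEntropy_eq_of_iso {S T : Tensor3 a b c} (h : Iso S T) :
    mixEntropy S T = samplerEntropy T := by
  unfold mixEntropy samplerEntropy mixSampler
  exact mixture_entropy_eq_of_law_eq (sampler S) (sampler T) (card_fiber_sampler_eq_of_iso h)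

/-! ### The entropy gap -/

/-- The abstract entropy gap of the monoid-randomised mixture for CONCISE
non-isomorphic tensors: `H(mix) ≥ (H_S + H_T)/2 + 1/64` (event analysis + density feed the
Jensen–Shannon accounting lemma with `E` = concise outputs, `π` = density of invertible triples).
[card tensor-iso-monoid-import, First lemma (b)] -/
theorem mixEntropy_ge_of_event_density (S T : Tensor3 a b c)
    (hevent : ∀ X : Tensor3 a b c, Concise X → ∀ M : Triple a b c,
      Concise (tensorAct M X) ↔ IsUnitTriple M)
    (hdens : (Nat.card (Triple a b c) : ℝ) ≤ 64 * Nat.card {M : Triple a b c // IsUnitTriple M})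
    (hS : Concise S) (hT : Concise T) (hST : ¬ Iso S T) :
    (samplerEntropy S + samplerEntropy T) / 2 + 1 / 64 ≤ mixEntropy S T := by
  classical
  -- the event: concise outputs; its mass: the density of invertible triples
  set E : Set (Tensor3 a b c) := {U | Concise U} with hE
  set N : ℝ := (Fintype.card (Triple a b c) : ℝ) with hN
  set K : ℕ := (Finset.univ.filter fun M : Triple a b c => IsUnitTriple M).card with hK
  have hNpos : 0 < N := by rw [hN]; exact_mod_cast Fintype.card_pos
  set π : ℝ := (K : ℝ) / N with hπ
  -- on a concise tensor the event pulls back to the invertible triples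
  have hpre : ∀ X : Tensor3 a b c, Concise X →
      (Finset.univ.filter fun M : Triple a b c => sampler X M ∈ E) =
        Finset.univ.filter fun M : Triple a b c => IsUnitTriple M := by
    intro X hX
    ext M
    simp only [Finset.mem_filter, Finset.mem_univ, true_and, hE, Set.mem_setOf_eq, sampler]
    exact hevent X hX M
  have hmass : ∀ X : Tensor3 a b c, Concise X →
      ((Finset.univ.filter fun M : Triple a b c => sampler X M ∈ E).card : ℝ) =
        π * Fintype.card (Triple a b c) := by
    intro X hX
    rw [hpre X hX, ← hK, hπ, ← hN]
    field_simp
  have hdisj : ∀ M M' : Triple a b c, sampler S M ∈ E → sampler T M' ∈ E →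
      sampler S M ≠ sampler T M' := by
    intro M M' hM hM' heq
    have uM : IsUnitTriple M := (hevent S hS M).1 hM
    have uM' : IsUnitTriple M' := (hevent T hT M').1 hM'
    exact hST (iso_of_tensorAct_eq uM uM' heq)
  have key := stub_jsd (sampler S) (sampler T) E π (hmass S hS) (hmass T hT) hdisj
  -- the density bound: π ≥ 1/64
  have hKcard : (Nat.card {M : Triple a b c // IsUnitTriple M} : ℝ) = K := by
    rw [Nat.card_eq_fintype_card, Fintype.card_subtype, hK]
  have hNcard : (Nat.card (Triple a b c) : ℝ) = N := by
    rw [Nat.card_eq_fintype_card, hN]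
  have hπge : 1 / 64 ≤ π := by
    rw [hKcard, hNcard] at hdens
    rw [hπ, le_div_iff₀ hNpos]
    linarith
  have hmix : mixEntropy S T =
      mapEntropy (Finset.univ : Finset (Bool × Triple a b c))
        (fun p => if p.1 then sampler S p.2 else sampler T p.2) := rfl
  have hS' : samplerEntropy S = mapEntropy Finset.univ (sampler S) := rfl
  have hT' : samplerEntropy T = mapEntropy Finset.univ (sampler T) := rfl
  rw [hmix, hS', hT']
  linarith

/-- The invertible triples are the product of the three unit groups. [folklore] -/
def unitTripleEquiv (a b c : ℕ) :
    {M : Triple a b c // IsUnitTriple M} ≃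
      (Matrix (Fin a) (Fin a) (ZMod 2))ˣ × (Matrix (Fin b) (Fin b) (ZMod 2))ˣ ×
        (Matrix (Fin c) (Fin c) (ZMod 2))ˣ where
  toFun M := (M.2.1.unit, M.2.2.1.unit, M.2.2.2.unit)
  invFun u := ⟨((u.1 : Matrix (Fin a) (Fin a) (ZMod 2)), (u.2.1 : Matrix (Fin b) (Fin b) (ZMod 2)),
    (u.2.2 : Matrix (Fin c) (Fin c) (ZMod 2))), u.1.isUnit, u.2.1.isUnit, u.2.2.isUnit⟩
  left_inv M := by
    rcases M with ⟨⟨A, B, C⟩, hA, hB, hC⟩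
    simp
  right_inv u := by
    rcases u with ⟨u₁, u₂, u₃⟩
    simp

/-- `|M_n(F₂)| = 2^{n²}`. [folklore] -/
theorem natCard_matrix (n : ℕ) : Nat.card (Matrix (Fin n) (Fin n) (ZMod 2)) = 2 ^ (n * n) := by
  rw [Nat.card_eq_fintype_card]
  change Fintype.card (Fin n → Fin n → ZMod 2) = _
  rw [Fintype.card_fun, Fintype.card_fun, ZMod.card, Fintype.card_fin, ← pow_mul, mul_comm]

/-- Density of invertible triples: `|Triple| ≤ 64 · #{invertible triples}` (from `stub_density`).
[card tensor-orbit-two-query, S3] -/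
theorem card_triple_le (a b c : ℕ) :
    (Nat.card (Triple a b c) : ℝ) ≤ 64 * Nat.card {M : Triple a b c // IsUnitTriple M} := by
  rw [Nat.card_congr (unitTripleEquiv a b c)]
  simp only [Nat.card_prod, natCard_matrix]
  have ha' : ((2 : ℝ) ^ (a * a)) ≤ 4 * (Nat.card (Matrix (Fin a) (Fin a) (ZMod 2))ˣ : ℝ) := by
    exact_mod_cast stub_density a
  have hb' : ((2 : ℝ) ^ (b * b)) ≤ 4 * (Nat.card (Matrix (Fin b) (Fin b) (ZMod 2))ˣ : ℝ) := by
    exact_mod_cast stub_density b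
  have hc' : ((2 : ℝ) ^ (c * c)) ≤ 4 * (Nat.card (Matrix (Fin c) (Fin c) (ZMod 2))ˣ : ℝ) := by
    exact_mod_cast stub_density c
  push_cast
  calc (2 : ℝ) ^ (a * a) * (2 ^ (b * b) * 2 ^ (c * c))
      ≤ (4 * (Nat.card (Matrix (Fin a) (Fin a) (ZMod 2))ˣ : ℝ)) *
          ((4 * (Nat.card (Matrix (Fin b) (Fin b) (ZMod 2))ˣ : ℝ)) *
            (4 * (Nat.card (Matrix (Fin c) (Fin c) (ZMod 2))ˣ : ℝ))) := by
        gcongr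
    _ = _ := by ring

/-- **The entropy gap, YES side**: concise non-isomorphic `S, T` give `H(mix) ≥ (H_S+H_T)/2 + 1/64`.
[card tensor-iso-monoid-import] -/
theorem mixEntropy_ge {S T : Tensor3 a b c} (hS : Concise S) (hT : Concise T) (hST : ¬ Iso S T) :
    (samplerEntropy S + samplerEntropy T) / 2 + 1 / 64 ≤ mixEntropy S T :=
  mixEntropy_ge_of_event_density S T (fun X hX M => stub_event X hX M) (card_triple_le a b c) hS hT hST

/-- **stub_gap** (registered stub of the line): for CONCISE non-isomorphic tensors the
monoid-randomised mixture gains `1/64` bit over the average sampler entropy; for isomorphic tensors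
all three entropies agree. [card tensor-iso-monoid-import, First lemma (a)+(b)] -/
theorem stub_gap {a b c : ℕ} (S T : Tensor3 a b c) :
    (Concise S → Concise T → ¬ Iso S T →
      (samplerEntropy S + samplerEntropy T) / 2 + 1 / 64 ≤ mixEntropy S T) ∧
    (Iso S T → mixEntropy S T = samplerEntropy T ∧ samplerEntropy S = samplerEntropy T) :=
  ⟨fun hS hT hST => mixEntropy_ge hS hT hST,
    fun h => ⟨mixEntropy_eq_of_iso h, samplerEntropy_eq_of_iso h⟩⟩

end Summit.PneNP.PneNP.Cruxes.PeaThreeNotInP.TensorIsoLine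

end
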